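import Summits.Parity.BatemanHorn.Theorems.SoloInformedQuadraticDivisorSum

/-!
# Erdős's asymptotic for `∑ τ(g(n))` is EQUIVALENT to an asymptotic for the located root count — in the kernel

Solo informed line (Parity / Bateman–Horn), session 136.  `SoloInformedRootCountLevel` proves, for `g` irreducible of
positive degree with `n² ≤ |g(n)|` on `[1, ∞)`, `|S_g(x) − 2 Mid_g(x) − 2 A_g x log x| ≤ C x` (`x ≥ 2`), where
`S_g(x) = ∑_{n ≤ x} τ(|g(n)|)` and `Mid_g(x) = polyLocatedRootCount g x`.  Dividing by `x log x`:

* `tendsto_polyDivisorSum_div_iff` — for every `c`, `S_g(x)/(x log x) → c` **iff** `Mid_g(x)/(x log x) → (c − 2A_g)/2`.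
  So the existence of Erdős's constant `lim S_g(x)/(x log x)` (open for every `g` of degree `≥ 3`) is literally the
  existence of `lim Mid_g(x)/(x log x)`: an asymptotic count of roots of `g` modulo moduli in the window
  `(x, |g(n)|^{1/2})` past `x`.
* `tendsto_polyDivisorSum_cubic_div_iff` — the instance `n³ + 2`.
* `tendsto_divisorSum_sq_add_one_div` — degree 2 for contrast: `∑_{n ≤ x} τ(n² + 1)/(x log x) → 2A` with
  `A = rootLevelConst (X² + 1)`, unconditionally (`SoloInformedQuadraticDivisorSum`).
-/

open Finset Real Polynomial Filter Topology

namespace Summit.Parity.BatemanHorn.Theorems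

/-- If `|u(x)| ≤ C x` for `x ≥ 2` then `u(x)/(x log x) → 0`. -/
theorem tendsto_div_mul_log_of_abs_le {u : ℕ → ℝ} {C : ℝ} (hu : ∀ x : ℕ, 2 ≤ x → |u x| ≤ C * x) :
    Tendsto (fun x : ℕ => u x / ((x : ℝ) * Real.log x)) atTop (𝓝 0) := by
  have hlog : Tendsto (fun x : ℕ => Real.log (x : ℝ)) atTop atTop :=
    Real.tendsto_log_atTop.comp tendsto_natCast_atTop_atTop
  have h1 : Tendsto (fun x : ℕ => |C| / Real.log (x : ℝ)) atTop (𝓝 0) :=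
    tendsto_const_nhds.div_atTop hlog
  refine squeeze_zero_norm' ?_ h1
  filter_upwards [eventually_ge_atTop 2] with x hx
  have hx' : (2 : ℝ) ≤ x := by exact_mod_cast hx
  have hlogpos : 0 < Real.log (x : ℝ) := Real.log_pos (by linarith)
  have hxpos : (0 : ℝ) < x := by linarith
  rw [Real.norm_eq_abs, abs_div, abs_mul, abs_of_pos hxpos, abs_of_pos hlogpos]
  have hC : |u x| ≤ |C| * x := (hu x hx).trans (mul_le_mul_of_nonneg_right (le_abs_self C) hxpos.le)
  calc |u x| / ((x : ℝ) * Real.log x)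
      ≤ (|C| * x) / ((x : ℝ) * Real.log x) := div_le_div_of_nonneg_right hC (by positivity)
    _ = |C| / Real.log x := by rw [mul_comm |C| (x : ℝ), mul_div_mul_left _ _ hxpos.ne']

/-- **Erdős's asymptotic ⟺ located-root-count asymptotic.**  For `g` irreducible of positive degree with `n² ≤ |g(n)|`
for all `n ≥ 1`, and any `c ∈ ℝ`:
`∑_{n ≤ x} τ(|g(n)|) / (x log x) → c` iff `Mid_g(x) / (x log x) → (c − 2 A_g)/2`, `A_g = rootLevelConst g`. [this work] -/
theorem tendsto_polyDivisorSum_div_iff {g : ℤ[X]} (hirr : Irreducible g) (hdeg : 0 < g.natDegree)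
    (hsq : ∀ n : ℕ, 1 ≤ n → n * n ≤ (g.eval (n : ℤ)).natAbs) (c : ℝ) :
    Tendsto (fun x : ℕ => (polyDivisorSum g x : ℝ) / ((x : ℝ) * Real.log x)) atTop (𝓝 c) ↔
      Tendsto (fun x : ℕ => (polyLocatedRootCount g x : ℝ) / ((x : ℝ) * Real.log x)) atTop
        (𝓝 ((c - 2 * rootLevelConst g) / 2)) := by
  obtain ⟨C, hC⟩ := exists_abs_polyDivisorSum_sub_located_sub_log_le_uncond hirr hdeg hsq
  set A := rootLevelConst g with hA
  set S : ℕ → ℝ := fun x => (polyDivisorSum g x : ℝ) / ((x : ℝ) * Real.log x) with hS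
  set M : ℕ → ℝ := fun x => (polyLocatedRootCount g x : ℝ) / ((x : ℝ) * Real.log x) with hM
  have hE : Tendsto (fun x : ℕ => S x - 2 * M x - 2 * A) atTop (𝓝 0) := by
    have h0 := tendsto_div_mul_log_of_abs_le hC
    refine h0.congr' ?_
    filter_upwards [eventually_ge_atTop 2] with x hx
    have hx' : (2 : ℝ) ≤ x := by exact_mod_cast hx
    have hlogpos : 0 < Real.log (x : ℝ) := Real.log_pos (by linarith)
    have hne : (x : ℝ) * Real.log x ≠ 0 := by positivity
    simp only [hS, hM]
    field_simp
  constructor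
  · intro hSc
    have h : Tendsto (fun x => (S x - (S x - 2 * M x - 2 * A) - 2 * A) / 2) atTop
        (𝓝 ((c - 0 - 2 * A) / 2)) := ((hSc.sub hE).sub tendsto_const_nhds).div_const 2
    have h2 := h.congr (f₂ := M) (fun x => by ring)
    convert h2 using 2
    ring
  · intro hMc
    have h : Tendsto (fun x => (S x - 2 * M x - 2 * A) + 2 * M x + 2 * A) atTop
        (𝓝 (0 + 2 * ((c - 2 * A) / 2) + 2 * A)) := (hE.add (hMc.const_mul 2)).add tendsto_const_nhds
    have h2 := h.congr (f₂ := S) (fun x => by ring)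
    convert h2 using 2
    ring

/-- **The instance `n³ + 2`**: `∑_{n ≤ x} τ(n³+2)/(x log x) → c` iff `Mid(x)/(x log x) → (c − 2A)/2`,
`A = rootLevelConst (X³ + 2)` — Erdős's open asymptotic for the cubic IS the located-root-count asymptotic. -/
theorem tendsto_polyDivisorSum_cubic_div_iff (c : ℝ) :
    Tendsto (fun x : ℕ => (polyDivisorSum (X ^ 3 + C 2) x : ℝ) / ((x : ℝ) * Real.log x)) atTop (𝓝 c) ↔
      Tendsto (fun x : ℕ => (polyLocatedRootCount (X ^ 3 + C 2) x : ℝ) / ((x : ℝ) * Real.log x)) atTop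
        (𝓝 ((c - 2 * rootLevelConst (X ^ 3 + C 2)) / 2)) :=
  tendsto_polyDivisorSum_div_iff
    Literature.NumberTheory.Sieve.LargestPrimeFactorCubic.irreducible_X_pow_three_add_two
    (by rw [natDegree_X_pow_add_C]; norm_num) sq_le_natAbs_eval_cubic c

/-- **Degree 2 for contrast**: `∑_{n ≤ x} τ(n² + 1)/(x log x) → 2A`, `A = rootLevelConst (X² + 1)`,
unconditionally. -/
theorem tendsto_divisorSum_sq_add_one_div :
    Tendsto (fun x : ℕ => ((∑ n ∈ Icc 1 x, #((n ^ 2 + 1).divisors) : ℕ) : ℝ) / ((x : ℝ) * Real.log x))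
      atTop (𝓝 (2 * rootLevelConst (X ^ 2 + 1))) := by
  obtain ⟨C, hC⟩ := exists_abs_divisorSum_sq_add_one_sub_log_le
  set A := rootLevelConst (X ^ 2 + 1) with hA
  set S : ℕ → ℝ := fun x => ((∑ n ∈ Icc 1 x, #((n ^ 2 + 1).divisors) : ℕ) : ℝ) / ((x : ℝ) * Real.log x)
    with hS
  have hE : Tendsto (fun x : ℕ => S x - 2 * A) atTop (𝓝 0) := by
    have h0 := tendsto_div_mul_log_of_abs_le hC
    refine h0.congr' ?_
    filter_upwards [eventually_ge_atTop 2] with x hx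
    have hx' : (2 : ℝ) ≤ x := by exact_mod_cast hx
    have hlogpos : 0 < Real.log (x : ℝ) := Real.log_pos (by linarith)
    have hne : (x : ℝ) * Real.log x ≠ 0 := by positivity
    simp only [hS]
    field_simp
  have h : Tendsto (fun x => (S x - 2 * A) + 2 * A) atTop (𝓝 (0 + 2 * A)) := hE.add tendsto_const_nhds
  have h2 := h.congr (f₂ := S) (fun x => by ring)
  simpa using h2

end Summit.Parity.BatemanHorn.Theorems
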